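import Mathlib
import HarnessLib

/-!
# Blocks, polymers and small-set neighbourhoods on the discrete torus (Adams–Kotecký–Müller)

The hierarchical paving of the torus `Λ_N = (ℤ/L^N ℤ)^d` (`L` odd) underlying every finite-range
renormalisation group on the lattice: for `k = 0, …, N` the torus is paved by the `L^{(N−k)d}`
translates of the centred cube `{|x|_∞ ≤ (L^k − 1)/2}` by `L^k ℤ^d` ("`k`-blocks"); unions of
`k`-blocks are `k`-POLYMERS; a set is CONNECTED if it is connected in the graph `|x − y|_∞ = 1`;
the CLOSURE `X̄` of a `k`-polymer is the smallest `(k+1)`-polymer containing it; a connected polymer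
with at most `2^d` blocks is SMALL; the SMALL-SET NEIGHBOURHOOD `B*` of a block is the cube of side
`(2^{d+1} − 1) L^k` centred at `B`, and `X* = ⋃_{B ⊂ X} B*`.

Everything is phrased for a general side length `s` of the blocks (in the source `s = L^k`) on the
torus `(ℤ/M)^d` (in the source `M = L^N`), with points `x : Fin d → ZMod M` and coordinates read
through the symmetric representative `ZMod.valMinAbs`.  Definitions plus the elementary closure
properties (blocks of a point form a partition; polymers are closed under `∅`, union, difference,
the whole torus; `X ⊆ X̄`, `X̄` is a polymer of the next scale; `X ⊆ X*` is NOT proved here).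

## References
* S. Adams, R. Kotecký, S. Müller, *Strict convexity of the surface tension for non-convex
  potentials*, arXiv:1606.09541, Ch. 4, §"Polymers, polymer functionals, ideal Hamiltonians and
  norms" (blocks `𝓑_k`, polymers `𝓟_k`, connected polymers `𝓟_k^c`, `|X|_k`, closure `X̄`, small
  polymers `𝓢_k`, small-set neighbourhoods `B*`, `X*`) [AdamsKoteckyMuller2016].
* S. Adams, S. Buchholz, R. Kotecký, S. Müller, arXiv:1910.13564, Ch. 6–7 (same paving)
  [AdamsBuchholzKoteckyMuller2019].
-/

noncomputable section

namespace Literature.MathematicalPhysics.StatisticalMechanics.TorusPolymer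

open scoped BigOperators Classical

variable {d M : ℕ}

/-! ## Blocks -/

/-- Sup-norm `|x|_∞` of a torus point through symmetric representatives (non-Prop plumbing). [folklore] -/
def supNorm (x : Fin d → ZMod M) : ℕ :=
  Finset.univ.sup fun i => ((x i).valMinAbs).natAbs

/-- The index of the centred cube of (odd) side `s` containing the coordinate `x_i`:
`round(x_i / s) = ⌊(x_i + (s−1)/2)/s⌋` on the symmetric representative `x_i ∈ (−M/2, M/2]`.
For `M = L^N`, `s = L^k` (`L` odd) these cubes are the `k`-blocks: the translates of
`{|x|_∞ ≤ (L^k−1)/2}` by `L^k ℤ^d`. [cite: AdamsKoteckyMuller2016, Ch. 4] -/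
def cubeIndex (s : ℕ) (x : Fin d → ZMod M) (i : Fin d) : ℤ :=
  ((x i).valMinAbs + ((s : ℤ) - 1) / 2) / (s : ℤ)

/-- `x` and `y` lie in the same block of side `s`. [cite: AdamsKoteckyMuller2016, Ch. 4] -/
def SameBlock (s : ℕ) (x y : Fin d → ZMod M) : Prop :=
  ∀ i, cubeIndex s x i = cubeIndex s y i

/-- `sameBlock_refl` (elementary bookkeeping of the paving). [cite: AdamsKoteckyMuller2016, Ch. 4] -/
theorem sameBlock_refl (s : ℕ) (x : Fin d → ZMod M) : SameBlock s x x := fun _ => rfl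

/-- `SameBlock.symm` (elementary bookkeeping of the paving). [cite: AdamsKoteckyMuller2016, Ch. 4] -/
theorem SameBlock.symm {s : ℕ} {x y : Fin d → ZMod M} (h : SameBlock s x y) : SameBlock s y x :=
  fun i => (h i).symm

/-- `SameBlock.trans` (elementary bookkeeping of the paving). [cite: AdamsKoteckyMuller2016, Ch. 4] -/
theorem SameBlock.trans {s : ℕ} {x y z : Fin d → ZMod M} (h₁ : SameBlock s x y)
    (h₂ : SameBlock s y z) : SameBlock s x z :=
  fun i => (h₁ i).trans (h₂ i)

variable [NeZero M]

/-- The block of side `s` containing `x` (a `k`-block `B ∈ 𝓑_k` for `s = L^k`), as a finite set of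
torus points. [cite: AdamsKoteckyMuller2016, Ch. 4] -/
def blockOf (s : ℕ) (x : Fin d → ZMod M) : Finset (Fin d → ZMod M) :=
  Finset.univ.filter fun y => SameBlock s x y

/-- `mem_blockOf` (elementary bookkeeping of the paving). [cite: AdamsKoteckyMuller2016, Ch. 4] -/
theorem mem_blockOf {s : ℕ} {x y : Fin d → ZMod M} : y ∈ blockOf s x ↔ SameBlock s x y := by
  simp [blockOf]

/-- `mem_blockOf_self` (elementary bookkeeping of the paving). [cite: AdamsKoteckyMuller2016, Ch. 4] -/
theorem mem_blockOf_self (s : ℕ) (x : Fin d → ZMod M) : x ∈ blockOf s x :=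
  mem_blockOf.mpr (sameBlock_refl s x)

/-- blocks form a partition: two blocks that meet coincide. [cite: AdamsKoteckyMuller2016, Ch. 4] -/
theorem blockOf_eq_of_mem {s : ℕ} {x y : Fin d → ZMod M} (h : y ∈ blockOf s x) :
    blockOf s y = blockOf s x := by
  ext z
  rw [mem_blockOf, mem_blockOf]
  have hxy := mem_blockOf.mp h
  exact ⟨fun hz => hxy.trans hz, fun hz => hxy.symm.trans hz⟩

/-! ## Polymers -/

/-- `X` is a polymer of block side `s` (`X ∈ 𝓟_k` for `s = L^k`): a union of blocks, i.e. closed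
under the relation "same block". [cite: AdamsKoteckyMuller2016, Ch. 4] -/
def IsPolymer (s : ℕ) (X : Finset (Fin d → ZMod M)) : Prop :=
  ∀ x ∈ X, blockOf s x ⊆ X

/-- The number `|X|_k` of blocks of a polymer (number of distinct block indices met by `X`).
[cite: AdamsKoteckyMuller2016, Ch. 4] -/
def numBlocks (s : ℕ) (X : Finset (Fin d → ZMod M)) : ℕ :=
  (X.image fun x => fun i => cubeIndex s x i).card

/-- `isPolymer_empty` (elementary bookkeeping of the paving). [cite: AdamsKoteckyMuller2016, Ch. 4] -/
theorem isPolymer_empty (s : ℕ) : IsPolymer s (∅ : Finset (Fin d → ZMod M)) :=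
  fun x hx => absurd hx (Finset.notMem_empty x)

/-- `isPolymer_univ` (elementary bookkeeping of the paving). [cite: AdamsKoteckyMuller2016, Ch. 4] -/
theorem isPolymer_univ (s : ℕ) : IsPolymer s (Finset.univ : Finset (Fin d → ZMod M)) :=
  fun _ _ => Finset.subset_univ _

/-- `isPolymer_blockOf` (elementary bookkeeping of the paving). [cite: AdamsKoteckyMuller2016, Ch. 4] -/
theorem isPolymer_blockOf (s : ℕ) (x : Fin d → ZMod M) : IsPolymer s (blockOf s x) :=
  fun _ hy => (blockOf_eq_of_mem hy).le

/-- `IsPolymer.union` (elementary bookkeeping of the paving). [cite: AdamsKoteckyMuller2016, Ch. 4] -/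
theorem IsPolymer.union {s : ℕ} {X Y : Finset (Fin d → ZMod M)} (hX : IsPolymer s X)
    (hY : IsPolymer s Y) : IsPolymer s (X ∪ Y) := by
  intro x hx
  rcases Finset.mem_union.mp hx with h | h
  · exact (hX x h).trans Finset.subset_union_left
  · exact (hY x h).trans Finset.subset_union_right

/-- `IsPolymer.inter` (elementary bookkeeping of the paving). [cite: AdamsKoteckyMuller2016, Ch. 4] -/
theorem IsPolymer.inter {s : ℕ} {X Y : Finset (Fin d → ZMod M)} (hX : IsPolymer s X)
    (hY : IsPolymer s Y) : IsPolymer s (X ∩ Y) := by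
  intro x hx
  rcases Finset.mem_inter.mp hx with ⟨h1, h2⟩
  exact Finset.subset_inter (hX x h1) (hY x h2)

/-- the set difference of two polymers is a polymer. [cite: AdamsKoteckyMuller2016, Ch. 4] -/
theorem IsPolymer.sdiff {s : ℕ} {X Y : Finset (Fin d → ZMod M)} (hX : IsPolymer s X)
    (hY : IsPolymer s Y) : IsPolymer s (X \ Y) := by
  intro x hx z hz
  rcases Finset.mem_sdiff.mp hx with ⟨hxX, hxY⟩
  refine Finset.mem_sdiff.mpr ⟨hX x hxX hz, fun hzY => hxY ?_⟩
  have := hY z hzY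
  rw [blockOf_eq_of_mem hz] at this
  exact this (mem_blockOf_self s x)

/-! ## Connectedness -/

/-- `∞`-adjacency on the torus: `|x − y|_∞ = 1` (the graph in which connectedness is taken).
[cite: AdamsKoteckyMuller2016, Ch. 4] -/
def Adj (x y : Fin d → ZMod M) : Prop := supNorm (x - y) = 1

/-- `X` is connected: any two points of `X` are joined by a chain of `∞`-adjacent points of `X`
(the empty set and singletons are connected). [cite: AdamsKoteckyMuller2016, Ch. 4] -/
def IsConnectedSet (X : Finset (Fin d → ZMod M)) : Prop :=
  ∀ x ∈ X, ∀ y ∈ X, Relation.ReflTransGen (fun a b => a ∈ X ∧ b ∈ X ∧ Adj a b) x y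

/-- two sets are strictly disjoint if their union is not connected. [cite: AdamsKoteckyMuller2016, Ch. 4] -/
def StrictlyDisjoint (X Y : Finset (Fin d → ZMod M)) : Prop :=
  ¬ IsConnectedSet (X ∪ Y)

/-- connected non-empty polymers `𝓟_k^c` (`∅ ∉ 𝓟_k^c`). [cite: AdamsKoteckyMuller2016, Ch. 4] -/
def IsConnectedPolymer (s : ℕ) (X : Finset (Fin d → ZMod M)) : Prop :=
  IsPolymer s X ∧ X.Nonempty ∧ IsConnectedSet X

/-- small polymers `𝓢_k`: connected, non-empty, with at most `2^d` blocks.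
[cite: AdamsKoteckyMuller2016, Ch. 4] -/
def IsSmall (s : ℕ) (X : Finset (Fin d → ZMod M)) : Prop :=
  IsConnectedPolymer s X ∧ numBlocks s X ≤ 2 ^ d

/-! ## Closure and small-set neighbourhoods -/

/-- The closure `X̄` of `X` with respect to blocks of side `s'` (in the source `s' = L^{k+1}` for a
`k`-polymer `X`): the union of the `s'`-blocks meeting `X`, i.e. the smallest `s'`-polymer
containing `X`. [cite: AdamsKoteckyMuller2016, Ch. 4] -/
def closure (s' : ℕ) (X : Finset (Fin d → ZMod M)) : Finset (Fin d → ZMod M) :=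
  Finset.univ.filter fun y => ∃ x ∈ X, SameBlock s' x y

/-- `mem_closure` (elementary bookkeeping of the paving). [cite: AdamsKoteckyMuller2016, Ch. 4] -/
theorem mem_closure {s' : ℕ} {X : Finset (Fin d → ZMod M)} {y : Fin d → ZMod M} :
    y ∈ closure s' X ↔ ∃ x ∈ X, SameBlock s' x y := by
  simp [closure]

/-- `subset_closure` (elementary bookkeeping of the paving). [cite: AdamsKoteckyMuller2016, Ch. 4] -/
theorem subset_closure (s' : ℕ) (X : Finset (Fin d → ZMod M)) : X ⊆ closure s' X :=
  fun x hx => mem_closure.mpr ⟨x, hx, sameBlock_refl s' x⟩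

/-- `X̄` is a polymer of the next scale. [cite: AdamsKoteckyMuller2016, Ch. 4] -/
theorem isPolymer_closure (s' : ℕ) (X : Finset (Fin d → ZMod M)) : IsPolymer s' (closure s' X) := by
  intro y hy z hz
  obtain ⟨x, hx, hxy⟩ := mem_closure.mp hy
  exact mem_closure.mpr ⟨x, hx, hxy.trans (mem_blockOf.mp hz)⟩

/-- `X̄` is the smallest polymer of the next scale containing `X`. [cite: AdamsKoteckyMuller2016, Ch. 4] -/
theorem closure_subset_of_isPolymer {s' : ℕ} {X Y : Finset (Fin d → ZMod M)} (hXY : X ⊆ Y)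
    (hY : IsPolymer s' Y) : closure s' X ⊆ Y := by
  intro y hy
  obtain ⟨x, hx, hxy⟩ := mem_closure.mp hy
  exact hY x (hXY hx) (mem_blockOf.mpr hxy)

/-- The centre of the block of side `s` containing `x` (coordinates `s · round(x_i/s)`). [folklore] -/
def blockCenter (s : ℕ) (x : Fin d → ZMod M) : Fin d → ZMod M :=
  fun i => ((cubeIndex s x i * (s : ℤ) : ℤ) : ZMod M)

/-- The small-set neighbourhood `B*` of the block `B ∋ x` of side `s`: the cube of side
`(2^{d+1} − 1)·s` centred at `B` (the smallest cube containing every small polymer through `B`).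
[cite: AdamsKoteckyMuller2016, Ch. 4] -/
def blockNbhd (s : ℕ) (x : Fin d → ZMod M) : Finset (Fin d → ZMod M) :=
  Finset.univ.filter fun y => supNorm (y - blockCenter s x) ≤ ((2 ^ (d + 1) - 1) * s - 1) / 2

/-- The small-set neighbourhood `X* = ⋃_{B ∈ 𝓑_k(X)} B*` of a polymer. [cite: AdamsKoteckyMuller2016, Ch. 4] -/
def polymerNbhd (s : ℕ) (X : Finset (Fin d → ZMod M)) : Finset (Fin d → ZMod M) :=
  X.biUnion fun x => blockNbhd s x

/-- `blockNbhd_eq_of_sameBlock` (elementary bookkeeping of the paving). [cite: AdamsKoteckyMuller2016, Ch. 4] -/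
theorem blockNbhd_eq_of_sameBlock {s : ℕ} {x y : Fin d → ZMod M} (h : SameBlock s x y) :
    blockNbhd s x = blockNbhd s y := by
  have hc : blockCenter s x = blockCenter s y := by
    funext i
    simp only [blockCenter, h i]
  simp only [blockNbhd, hc]

/-- `polymerNbhd_mono` (elementary bookkeeping of the paving). [cite: AdamsKoteckyMuller2016, Ch. 4] -/
theorem polymerNbhd_mono {s : ℕ} {X Y : Finset (Fin d → ZMod M)} (h : X ⊆ Y) :
    polymerNbhd s X ⊆ polymerNbhd s Y :=
  Finset.biUnion_subset_biUnion_of_subset_left _ h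

end Literature.MathematicalPhysics.StatisticalMechanics.TorusPolymer

end
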